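import Mathlib
import HarnessLib
import Literature.NumberTheory.LFunctions.ZetaScrew
import Literature.NumberTheory.LFunctions.SelbergDeltaPrimeSide
import Summits.RiemannHypothesis.RiemannHypothesis.Theorems.IntegerScrewPivotLogBound

/-!
# Route `IntegerScrew`, LINE «SCREW DEPTH–HEIGHT DICTIONARY» (rh-idea-10/A) — INTEGER SAMPLING of the
# screw function at depth `≥ 20` (item `stmt-RiemannHypothesis-21807`, `ZetaScrewSampling`)

For every real `L ≥ 20` there is an integer `2 ≤ m ≤ e^L` with `|Ψ(log m) − Ψ(L)| ≤ 1/2`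
(`Ψ = zetaScrew`, Suzuki's screw function of `ζ`, (1.1) of [Suzuki2023]).  Witness `m = ⌊e^L⌋`:
then `t = log m ∈ [0, L]`, `L − t ≤ 1/m`, and `⌊e^t⌋ = m = ⌊e^L⌋`, so the prime sums of `Ψ(t)` and
`Ψ(L)` run over THE SAME range `1 ≤ n ≤ m` and no derivative / no prime number theorem is needed:
termwise (`zetaScrew_eq`)

* archimedean: `0 ≤ e^{L/2} − e^{t/2} ≤ √m·(L − t) ≤ 1/√m`, `0 ≤ e^{−t/2} − e^{−L/2} ≤ (L−t)/2 ≤ 1/(2m)`;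
* prime sum: `φ(L) − φ(t) = (L − t)·Σ_{n≤m} Λ(n)/√n ∈ [0, 2 log m/√m] ⊆ [0, 8/m^{1/4}]`
  (`Λ(n) ≤ log m`, `Σ_{n≤m} n^{−1/2} ≤ 2√m` (`SelbergDelta.sum_inv_sqrt_le`), `log m ≤ 4·m^{1/4}`);
* linear term: `(L − t)κ/2 ≤ 7/(2m)` (`κ = γ₀ + π/2 + 3 log 2 + log π ≤ 7`);
* Hurwitz–Lerch term: both `e^{−u/2}Φ(e^{−2u},2,¼)` (`u = t, L`) lie in `[0, C/√m]`, `C ≤ 18`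
  (`tsum_one_div_nat_add_quarter_sq_le`).

With `m ≥ ⌊e^{20}⌋ ≥ 4.84·10⁸` (`e > 2.718`) the total is `< 0.06 ≤ 1/2`.  All inputs are the
explicit definition `zetaScrew_eq` and elementary real analysis; RH is NOT proved by this file and
nothing here bears on the truth of RH.  Reference: M. Suzuki, *J. Lond. Math. Soc.* (2) 108 (2023)
1448–1487, (1.1) [Suzuki2023].
-/

noncomputable section

-- D-0017: `Summit.<S>.<S>.…` is the designed namespace of a single-problem summit.
set_option linter.dupNamespace false

namespace Summit.RiemannHypothesis.RiemannHypothesis.Theorems.IntegerScrew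

open Finset Literature.NumberTheory.LFunctions

/-- The half-line prime sum is small against `m`: `0 ≤ Σ_{1≤n≤m} Λ(n)/√n ≤ log m · 2√m`. [folklore] -/
theorem sum_Icc_vonMangoldt_div_sqrt_le (m : ℕ) :
    0 ≤ ∑ n ∈ Finset.Icc 1 m, ArithmeticFunction.vonMangoldt n / Real.sqrt n ∧
      ∑ n ∈ Finset.Icc 1 m, ArithmeticFunction.vonMangoldt n / Real.sqrt n ≤
        Real.log m * (2 * Real.sqrt m) := by
  refine ⟨Finset.sum_nonneg fun n _ => div_nonneg ArithmeticFunction.vonMangoldt_nonneg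
    (Real.sqrt_nonneg _), ?_⟩
  calc ∑ n ∈ Finset.Icc 1 m, ArithmeticFunction.vonMangoldt n / Real.sqrt n
      ≤ ∑ n ∈ Finset.Icc 1 m, Real.log m * (1 / Real.sqrt n) := by
        refine Finset.sum_le_sum fun n hn => ?_
        rw [Finset.mem_Icc] at hn
        rw [div_eq_mul_one_div]
        refine mul_le_mul_of_nonneg_right ?_ (by positivity)
        refine ArithmeticFunction.vonMangoldt_le_log.trans ?_
        exact Real.log_le_log (by exact_mod_cast hn.1) (by exact_mod_cast hn.2)
    _ = Real.log m * ∑ n ∈ Finset.Icc 1 m, 1 / Real.sqrt n := by rw [Finset.mul_sum]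
    _ ≤ Real.log m * (2 * Real.sqrt m) := by
        rcases Nat.eq_zero_or_pos m with rfl | hm
        · simp
        · exact mul_le_mul_of_nonneg_left (SelbergDelta.sum_inv_sqrt_le m)
            (Real.log_nonneg (by exact_mod_cast hm))

/-- `κ = γ₀ + π/2 + 3 log 2 + log π ∈ [0, 7]` (crude: `γ₀ < 2/3`, `π < 3.15`, `log 2 < 0.7`,
`log π ≤ π − 1`). [folklore] -/
theorem screwSlope_nonneg_le_seven :
    0 ≤ Real.eulerMascheroniConstant + Real.pi / 2 + 3 * Real.log 2 + Real.log Real.pi ∧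
      Real.eulerMascheroniConstant + Real.pi / 2 + 3 * Real.log 2 + Real.log Real.pi ≤ 7 := by
  have hγ := Real.one_half_lt_eulerMascheroniConstant
  have hγ' := Real.eulerMascheroniConstant_lt_two_thirds
  have hπ := Real.pi_gt_three
  have hπ' := Real.pi_lt_d2
  have h2 := Real.log_two_gt_d9
  have h2' := Real.log_two_lt_d9
  have hlπ : 0 ≤ Real.log Real.pi := Real.log_nonneg (by linarith)
  have hlπ' : Real.log Real.pi ≤ Real.pi - 1 := Real.log_le_sub_one_of_pos Real.pi_pos
  constructor <;> linarith

/-- `e^{20} ≥ 4.84·10⁸` (from `e > 2.718`). [folklore] -/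
theorem exp_twenty_ge : (484000000 : ℝ) ≤ Real.exp 20 := by
  have h1 : (2.718 : ℝ) ≤ Real.exp 1 := (lt_trans (by norm_num) Real.exp_one_gt_d9).le
  have h2 : (2.718 : ℝ) ^ 20 ≤ Real.exp 1 ^ 20 := pow_le_pow_left₀ (by norm_num) h1 20
  have h3 : Real.exp 1 ^ 20 = Real.exp 20 := by
    rw [← Real.exp_nat_mul]; norm_num
  have h4 : (484000000 : ℝ) ≤ (2.718 : ℝ) ^ 20 := by norm_num
  linarith

/-- The final bookkeeping of the sampling estimate (pure arithmetic). [folklore] -/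
theorem sampling_bookkeeping {E₁ E₂ P K H : ℝ} (h₁ : 0 ≤ E₁) (h₁' : E₁ ≤ 1 / 20000)
    (h₂ : 0 ≤ E₂) (h₂' : E₂ ≤ 1 / 20000) (h₃ : 0 ≤ P) (h₃' : P ≤ 8 / 148) (h₄ : 0 ≤ K)
    (h₄' : K ≤ 1 / 20000) (h₅ : |H| ≤ 1 / 1000) :
    |-(4 * E₁) + 4 * E₂ + P + K - 1 / 4 * H| ≤ 1 / 2 := by
  obtain ⟨h5a, h5b⟩ := abs_le.1 h₅
  rw [abs_le]; constructor <;> linarith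

/-- The sampling estimate for a given large integer `m` just below `e^L`: if `4.84·10⁸ ≤ m ≤ e^L < m + 1`
then `|Ψ(log m) − Ψ(L)| ≤ 1/2` (in fact `< 0.06`). [folklore] -/
theorem abs_zetaScrew_log_sub_le_half {L : ℝ} {m : ℕ} (hm : 484000000 ≤ m)
    (hmL : (m : ℝ) ≤ Real.exp L) (hLm : Real.exp L < (m : ℝ) + 1) (hfloor : ⌊Real.exp L⌋₊ = m) :
    |zetaScrew (Real.log m) - zetaScrew L| ≤ 1 / 2 := by
  -- basic quantities
  have hm1 : (1 : ℝ) ≤ m := by exact_mod_cast (show 1 ≤ m by omega)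
  have hm0 : (0 : ℝ) < m := by positivity
  have hmR : (484000000 : ℝ) ≤ m := by exact_mod_cast hm
  set t : ℝ := Real.log m with ht_def
  have ht0 : 0 ≤ t := Real.log_nonneg hm1
  have htL : t ≤ L := (Real.log_le_iff_le_exp hm0).2 hmL
  have hL0 : 0 ≤ L := ht0.trans htL
  have hexp_t : Real.exp t = m := Real.exp_log hm0
  -- the two instances of Suzuki's formula (1.1) (`|t| = t`, `|L| = L`)
  have e1 := zetaScrew_eq t
  have e2 := zetaScrew_eq L
  rw [abs_of_nonneg ht0] at e1
  rw [abs_of_nonneg hL0] at e2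
  -- `0 ≤ L - t ≤ 1/m`
  have hδ0 : 0 ≤ L - t := sub_nonneg.2 htL
  have hδ : L - t ≤ 1 / m := by
    have h1 : L < Real.log ((m : ℝ) + 1) := (Real.lt_log_iff_exp_lt (by positivity)).2 hLm
    have h2 : Real.log ((m : ℝ) + 1) - t = Real.log (((m : ℝ) + 1) / m) := by
      rw [Real.log_div (by positivity) hm0.ne']
    have h3 : Real.log (((m : ℝ) + 1) / m) ≤ ((m : ℝ) + 1) / m - 1 :=
      Real.log_le_sub_one_of_pos (by positivity)
    have h4 : ((m : ℝ) + 1) / m - 1 = 1 / m := by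
      field_simp
      ring
    linarith
  have hδ1 : L - t ≤ 1 := hδ.trans (by rw [div_le_one hm0]; exact hm1)
  -- square roots `r = √m = e^{t/2}`, `q = √r`
  set r : ℝ := Real.sqrt m with hr_def
  have hr0 : 0 < r := Real.sqrt_pos.2 hm0
  have hrr : r * r = m := Real.mul_self_sqrt hm0.le
  have hr : (22000 : ℝ) ≤ r := by
    rw [hr_def, Real.le_sqrt (by norm_num) hm0.le]; nlinarith
  set q : ℝ := Real.sqrt r with hq_def
  have hq0 : 0 < q := Real.sqrt_pos.2 hr0
  have hqq : q * q = r := Real.mul_self_sqrt hr0.le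
  have hq : (148 : ℝ) ≤ q := by
    rw [hq_def, Real.le_sqrt (by norm_num) hr0.le]; nlinarith
  have hEt : Real.exp (t / 2) = r := by
    rw [Real.exp_half, hexp_t]
  have het : Real.exp (-(t / 2)) = r⁻¹ := by rw [Real.exp_neg, hEt]
  have hEL : Real.exp (L / 2) = r * Real.exp ((L - t) / 2) := by
    rw [← hEt, ← Real.exp_add]; congr 1; ring
  have heL : Real.exp (-(L / 2)) = r⁻¹ * Real.exp (-((L - t) / 2)) := by
    rw [← het, ← Real.exp_add]; congr 1; ring
  -- `log m ≤ 4 q`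
  have hlogm : Real.log m ≤ 4 * q := by
    have h1 : Real.log r = Real.log m / 2 := by rw [hr_def, Real.log_sqrt hm0.le]
    have h2 : Real.log q = Real.log r / 2 := by rw [hq_def, Real.log_sqrt hr0.le]
    have h3 : Real.log q ≤ q - 1 := Real.log_le_sub_one_of_pos hq0
    linarith
  -- the constants
  obtain ⟨hκ0, hκ7⟩ := screwSlope_nonneg_le_seven
  set κ : ℝ := Real.eulerMascheroniConstant + Real.pi / 2 + 3 * Real.log 2 + Real.log Real.pi
    with hκ_def
  set C : ℝ := ∑' k : ℕ, 1 / ((k : ℝ) + 1 / 4) ^ 2 with hC_def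
  have hC18 : C ≤ 18 := tsum_one_div_nat_add_quarter_sq_le
  -- (1) archimedean terms
  have hexpδ : Real.exp ((L - t) / 2) ≤ 1 + (L - t) := by
    have habs : |(L - t) / 2| ≤ 1 := by
      rw [abs_of_nonneg (by linarith)]
      linarith
    have h := (abs_le.1 (Real.abs_exp_sub_one_sub_id_le habs)).2
    have hsq : ((L - t) / 2) ^ 2 ≤ (L - t) / 2 := by
      rw [sq]
      exact mul_le_of_le_one_left (by linarith) (by linarith)
    linarith
  have b1 : 0 ≤ Real.exp (L / 2) - Real.exp (t / 2) ∧
      Real.exp (L / 2) - Real.exp (t / 2) ≤ 1 / 20000 := by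
    constructor
    · exact sub_nonneg.2 (Real.exp_le_exp.2 (by linarith))
    · rw [hEL, hEt]
      have h1 : r * Real.exp ((L - t) / 2) - r ≤ r * (L - t) := by nlinarith only [hexpδ, hr0]
      have h2 : r * (L - t) ≤ r * (1 / m) := mul_le_mul_of_nonneg_left hδ hr0.le
      have h3 : r * (1 / m) = 1 / r := by
        rw [← hrr]; field_simp
      have h4 : 1 / r ≤ 1 / 20000 := one_div_le_one_div_of_le (by norm_num) (by linarith only [hr])
      linarith only [h1, h2, h3, h4]
  have b2 : 0 ≤ Real.exp (-(t / 2)) - Real.exp (-(L / 2)) ∧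
      Real.exp (-(t / 2)) - Real.exp (-(L / 2)) ≤ 1 / 20000 := by
    constructor
    · exact sub_nonneg.2 (Real.exp_le_exp.2 (by linarith))
    · have h1 : 1 - Real.exp (-((L - t) / 2)) ≤ (L - t) / 2 := by
        have := Real.add_one_le_exp (-((L - t) / 2)); linarith
      have h2 : Real.exp (-(t / 2)) ≤ 1 := by
        rw [Real.exp_le_one_iff]; linarith
      have h3 : 0 ≤ Real.exp (-(t / 2)) := (Real.exp_pos _).le
      have h4 : Real.exp (-(t / 2)) - Real.exp (-(L / 2))
          = Real.exp (-(t / 2)) * (1 - Real.exp (-((L - t) / 2))) := by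
        rw [heL, het]; ring
      rw [h4]
      have h5 : 0 ≤ 1 - Real.exp (-((L - t) / 2)) := by
        rw [sub_nonneg, Real.exp_le_one_iff]; linarith
      have h6 : (L - t) / 2 ≤ 1 / 20000 := by
        have : 1 / (m : ℝ) ≤ 1 / 484000000 := one_div_le_one_div_of_le (by norm_num) hmR
        linarith
      calc Real.exp (-(t / 2)) * (1 - Real.exp (-((L - t) / 2)))
          ≤ 1 * ((L - t) / 2) := mul_le_mul h2 h1 h5 zero_le_one
        _ ≤ 1 / 20000 := by linarith
  -- (2) prime-sum term
  set A : ℝ := ∑ n ∈ Finset.Icc 1 m, ArithmeticFunction.vonMangoldt n / Real.sqrt n with hA_def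
  obtain ⟨hA0, hAle⟩ := sum_Icc_vonMangoldt_div_sqrt_le m
  have b3 : 0 ≤ (L - t) * A ∧ (L - t) * A ≤ 8 / 148 := by
    refine ⟨mul_nonneg hδ0 hA0, ?_⟩
    have h1 : (L - t) * A ≤ (1 / m) * (4 * q * (2 * r)) :=
      mul_le_mul hδ (hAle.trans (mul_le_mul_of_nonneg_right hlogm (by positivity))) hA0
        (by positivity)
    have h2 : (1 / (m : ℝ)) * (4 * q * (2 * r)) = 8 / q := by
      rw [← hrr, ← hqq]; field_simp; ring
    have h3 : 8 / q ≤ 8 / 148 := div_le_div_of_nonneg_left (by norm_num) (by norm_num) hq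
    linarith
  -- (3) linear term
  have b4 : 0 ≤ (L - t) / 2 * κ ∧ (L - t) / 2 * κ ≤ 1 / 20000 := by
    refine ⟨mul_nonneg (by linarith) hκ0, ?_⟩
    have h1 : (L - t) / 2 * κ ≤ (1 / m) / 2 * 7 :=
      mul_le_mul (by linarith) hκ7 hκ0 (by positivity)
    have h2 : 1 / (m : ℝ) ≤ 1 / 484000000 := one_div_le_one_div_of_le (by norm_num) hmR
    linarith
  -- (4) Hurwitz–Lerch term
  have b5 : |Real.exp (-(t / 2)) * hurwitzLerchQuarter t
        - Real.exp (-(L / 2)) * hurwitzLerchQuarter L| ≤ 1 / 1000 := by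
    have hH1 := hurwitzLerchQuarter_nonneg t
    have hH2 := hurwitzLerchQuarter_nonneg L
    have hH3 : hurwitzLerchQuarter t ≤ 18 := (hurwitzLerchQuarter_le t).trans hC18
    have hH4 : hurwitzLerchQuarter L ≤ 18 := (hurwitzLerchQuarter_le L).trans hC18
    have he1 : 0 ≤ Real.exp (-(L / 2)) := (Real.exp_pos _).le
    have he2 : Real.exp (-(L / 2)) ≤ Real.exp (-(t / 2)) := Real.exp_le_exp.2 (by linarith)
    have he3 : Real.exp (-(t / 2)) ≤ 1 / 20000 := by
      rw [het, inv_eq_one_div]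
      exact one_div_le_one_div_of_le (by norm_num) (by linarith)
    have hx1 : Real.exp (-(t / 2)) * hurwitzLerchQuarter t ≤ 1 / 20000 * 18 :=
      mul_le_mul he3 hH3 hH1 (by norm_num)
    have hx2 : Real.exp (-(L / 2)) * hurwitzLerchQuarter L ≤ 1 / 20000 * 18 :=
      mul_le_mul (he2.trans he3) hH4 hH2 (by norm_num)
    have hx3 : 0 ≤ Real.exp (-(t / 2)) * hurwitzLerchQuarter t := mul_nonneg (Real.exp_pos _).le hH1
    have hx4 : 0 ≤ Real.exp (-(L / 2)) * hurwitzLerchQuarter L := mul_nonneg he1 hH2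
    rw [abs_le]
    constructor <;> linarith only [hx1, hx2, hx3, hx4]
  -- the prime sums run over the same range
  have hPS : zetaScrewPrimeSum L - zetaScrewPrimeSum t = (L - t) * A := by
    simp only [zetaScrewPrimeSum, abs_of_nonneg hL0, abs_of_nonneg ht0, hexp_t, Nat.floor_natCast,
      hfloor]
    rw [← Finset.sum_sub_distrib, hA_def, Finset.mul_sum]
    exact Finset.sum_congr rfl fun n _ => by ring
  -- the difference, term by term
  have hΔ : zetaScrew t - zetaScrew L =
      -(4 * (Real.exp (L / 2) - Real.exp (t / 2))) + 4 * (Real.exp (-(t / 2)) - Real.exp (-(L / 2)))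
        + (L - t) * A + (L - t) / 2 * κ
        - (1 / 4) * (Real.exp (-(t / 2)) * hurwitzLerchQuarter t
            - Real.exp (-(L / 2)) * hurwitzLerchQuarter L) := by
    rw [e1, e2]
    linear_combination hPS
  -- total
  rw [hΔ]
  exact sampling_bookkeeping b1.1 b1.2 b2.1 b2.2 b3.1 b3.2 b4.1 b4.2 b5

/-- **Item `stmt-RiemannHypothesis-21807` (`IntegerScrew.ZetaScrewSampling`), literally.**  For every
real `L ≥ 20` there is an integer `m` with `2 ≤ m ≤ e^L` and `|Ψ(log m) − Ψ(L)| ≤ 1/2`; witness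
`m = ⌊e^L⌋` (`abs_zetaScrew_log_sub_le_half`).  RH is not proved by this; nothing here bears on the
truth of RH. -/
theorem zetaScrewSampling : ∀ L : ℝ, 20 ≤ L → ∃ m : ℕ, 2 ≤ m ∧ (m : ℝ) ≤ Real.exp L ∧ |Literature.NumberTheory.LFunctions.zetaScrew (Real.log m) - Literature.NumberTheory.LFunctions.zetaScrew L| ≤ 1 / 2 := by
  intro L hL
  have hexpL : (484000000 : ℝ) ≤ Real.exp L := exp_twenty_ge.trans (Real.exp_le_exp.2 hL)
  have hm : 484000000 ≤ ⌊Real.exp L⌋₊ := Nat.le_floor (by exact_mod_cast hexpL)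
  refine ⟨⌊Real.exp L⌋₊, by omega, Nat.floor_le (Real.exp_pos L).le, ?_⟩
  exact abs_zetaScrew_log_sub_le_half hm (Nat.floor_le (Real.exp_pos L).le)
    (Nat.lt_floor_add_one _) rfl

end Summit.RiemannHypothesis.RiemannHypothesis.Theorems.IntegerScrew

end
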